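import Summits.ABC.StewartYu.PadicG3ParE
import HarnessLib

/-!
# The `p`-adic Gen-3 parameter record — part F: the `Y₀`-rescaling allowance, the corrected masters, and the schedule lemma for any multiplicity

Support file (one closed form + plain theorems; no named facts). Continues `PadicG3ParE`.

1. **The rescaling allowance `AD E = Mord₀₀ · E`.** At level `s` the `Y₀`-variable is `2^{Ŝ−s}·x` (at `p = 2`:
   `3^{I*−I}·x`), so the `t₀`-th Hasse derivative in the node variable of the `Y₀`-weight carries the factor
   `2^{(Ŝ−s)t₀}` (`3^{(I*−I)t₀}`), `t₀ ≤ Mord₀₀` — Nesterenko (4.20)'s `2^{t₀(S−s)}`; p5's `M₀ I x τ ≥ 3^{(I*−I)τ₀}·…`.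
   This factor was NOT in `logK` of part D; here `AD E` with `E = Ŝ·log 2` (resp. `(I*+1)·log 3`) `≤ W_L` covers it:
   `AD E ≤ (7/27)·Z` for every `E ≤ W_L`, and `Ŝ log 2 ≤ W_L` (`two_mul_two_pow_Sdepth_le_L`).
2. **The corrected master inequalities** (the ones the frames should instantiate): with `Z = G·X·L`,
   (B3′) `AY + logK ν + AD E + 1 ≤ zeros s ν`, (B4′) `AY + 2ⁿ·(logK 0 + AD E + 1) ≤ zeros s n`,
   (C0′) `AY + Acond s ν + 2ⁿ·(logK 0 + AD E + 1) < U` for `U ≥ 8·2ⁿ·Z`, all for any `E ≤ W_L`.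
3. **The schedule lemma for an arbitrary multiplicity** `t ≤ 8L` (so that the `q = 3` column `T_I = ⌊4L/3^I⌋`,
   `X_I = ⌊4XL/(T_I+1)⌋` of the `p = 2` frame gets the same floors): `(31/8)·X·L ≤ ⌊4XL/(t+1)⌋·(t+1) ≤ 4XL`, `1 ≤ ⌊4XL/(t+1)⌋`.
WHAT THIS IS NOT: the `q = 3` masters (they are stated against p5's `G3TwoSched` slots when those land).

## References
* [Nesterenko2003] Yu. V. Nesterenko, *Linear forms in logarithms of rational numbers*, LNM 1819
  (2003) 53–106 — §4.2 (4.20)–(4.23), (4.3).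
-/

noncomputable section

open Finset Real

namespace Summit.ABC.StewartYu

namespace PadicG3Par

variable {n : ℕ} (P : PadicG3Par n)

/-! ### The rescaling allowance -/

/-- the `Y₀`-rescaling allowance `AD E = Mord 0 0 · E` (`E = Ŝ log 2` at `q = 2`, `(I*+1) log 3` at `q = 3`).
[cite: Nesterenko2003, (4.20)] -/
def AD (E : ℝ) : ℝ := P.Mord 0 0 * E

/-- `Ŝ · log 2 ≤ log L − log 2 ≤ W_L` (as `2·2^Ŝ ≤ L`). [folklore] -/
theorem Sdepth_log_two_le_WL : (P.Sdepth : ℝ) * Real.log 2 ≤ P.WL := by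
  have h : (2 : ℝ) * 2 ^ P.Sdepth ≤ P.L := by exact_mod_cast P.two_mul_two_pow_Sdepth_le_L
  have hL : (0 : ℝ) < P.L := by linarith [P.one_le_L]
  have h1 : Real.log ((2 : ℝ) * 2 ^ P.Sdepth) ≤ Real.log P.L := Real.log_le_log (by positivity) h
  rw [Real.log_mul (by norm_num) (by positivity), Real.log_pow] at h1
  have h2 := P.log_L_le_WL
  have h3 : 0 ≤ Real.log 2 := Real.log_nonneg (by norm_num)
  linarith

/-- **`AD E ≤ (7/27) · Z`** for `0 ≤ E ≤ W_L` (`Mord₀₀ ≤ (448/27)(n+1)L`, `(n+1) L W_L ≤ Z/64`). [folklore] -/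
theorem AD_le {E : ℝ} (hE0 : 0 ≤ E) (hE : E ≤ P.WL) : P.AD E ≤ (7 / 27) * (P.G * P.X * P.L) := by
  have hM := P.Mord_zero_zero_le'
  have hW := P.WL_mul_le
  have hL : (0 : ℝ) ≤ P.L := by positivity
  have hn : (0 : ℝ) ≤ (n : ℝ) + 1 := by positivity
  unfold AD
  calc (P.Mord 0 0 : ℝ) * E ≤ ((448 / 27) * (n + 1) * P.L) * E := mul_le_mul_of_nonneg_right hM hE0
    _ ≤ ((448 / 27) * (n + 1) * P.L) * P.WL := mul_le_mul_of_nonneg_left hE (by positivity)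
    _ = (448 / 27) * ((n + 1) * P.L * P.WL) := by ring
    _ ≤ (448 / 27) * (P.G * P.X * P.L / 64) := mul_le_mul_of_nonneg_left hW (by norm_num)
    _ = (7 / 27) * (P.G * P.X * P.L) := by ring

/-- `0 ≤ AD E` for `0 ≤ E`. [folklore] -/
theorem AD_nonneg {E : ℝ} (hE0 : 0 ≤ E) : 0 ≤ P.AD E := by unfold AD; positivity

/-! ### The corrected master inequalities -/

/-- **(B3′) k-step with the rescaling factor**: `AY + logK ν + AD E + 1 ≤ zeros s ν` (`0 ≤ E ≤ W_L`).
[cite: Nesterenko2003, §4.2 (4.29)–(4.34)] -/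
theorem kstep_budget' (s ν : ℕ) {E : ℝ} (hE0 : 0 ≤ E) (hE : E ≤ P.WL) :
    P.AY + P.logK ν + P.AD E + 1 ≤ P.zeros s ν := by
  have hz := P.zeros_ge s ν
  have hAY := P.AY_le
  have hAH := P.AH_le
  have hAV := P.AV_le
  have hAW := P.AW_le
  have hl := P.lunk_le
  have hh0 := P.hts_le 0
  have hhν := P.hts_le ν
  have hsm := P.small_le
  have hZ := P.GXL_ge
  have hD := P.AD_le hE0 hE
  have h2ν : (1 : ℝ) ≤ 2 ^ ν := one_le_pow₀ (by norm_num)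
  have hH0 : (0 : ℝ) ≤ P.H := by positivity
  have hG0 : (0 : ℝ) ≤ P.G := le_trans (by norm_num) P.sixteen_le_G
  have hZ0 : 0 ≤ P.G * P.X * P.L := by linarith
  unfold logK Acoef
  simp only [pow_zero, one_mul] at hh0
  have hνZ : P.G * P.X * P.L ≤ 2 ^ ν * (P.G * P.X * P.L) := by nlinarith
  linarith

/-- **(B4′) half-step with the rescaling factor**: `AY + 2ⁿ · (logK 0 + AD E + 1) ≤ zeros s n` (`0 ≤ E ≤ W_L`).
[cite: Nesterenko2003, §4.3 (4.39)–(4.45)] -/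
theorem halfstep_budget' (s : ℕ) {E : ℝ} (hE0 : 0 ≤ E) (hE : E ≤ P.WL) :
    P.AY + 2 ^ n * (P.logK 0 + P.AD E + 1) ≤ P.zeros s n := by
  have hz := P.zeros_ge s n
  have hAY := P.AY_le
  have hAH := P.AH_le
  have hAV := P.AV_le
  have hAW := P.AW_le
  have hl := P.lunk_le
  have hh0 := P.hts_le 0
  have hsm := P.small_le
  have hZ := P.GXL_ge
  have hD := P.AD_le hE0 hE
  have h2n : (2 : ℝ) ≤ 2 ^ n := by
    calc (2 : ℝ) = 2 ^ 1 := by norm_num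
      _ ≤ 2 ^ n := pow_le_pow_right₀ (by norm_num) P.hn
  have hH0 : (0 : ℝ) ≤ P.H := by positivity
  have hG0 : (0 : ℝ) ≤ P.G := le_trans (by norm_num) P.sixteen_le_G
  have hY0 : 0 ≤ P.yload := P.yload_pos.le
  simp only [pow_zero, one_mul] at hh0
  have hK : P.logK 0 + P.AD E + 1 ≤ (535 / 100) * (P.G * P.X * P.L) := by
    unfold logK Acoef; linarith
  have h2n0 : (0 : ℝ) ≤ 2 ^ n := by positivity
  nlinarith [mul_le_mul_of_nonneg_left hK h2n0]

/-- **(C0′) order budget with the rescaling factor**: for `U ≥ 8 · 2ⁿ · G X L` and `ν ≤ n`,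
`AY + Acond s ν + 2ⁿ · (logK 0 + AD E + 1) < U` (`0 ≤ E ≤ W_L`). [cite: Nesterenko2003, §4.2 (4.30)–(4.31)] -/
theorem order_budget' (s : ℕ) {ν : ℕ} (hν : ν ≤ n) {E : ℝ} (hE0 : 0 ≤ E) (hE : E ≤ P.WL) {U : ℝ}
    (hU : 8 * 2 ^ n * (P.G * P.X * P.L) ≤ U) :
    P.AY + P.Acond s ν + 2 ^ n * (P.logK 0 + P.AD E + 1) < U := by
  have hAY := P.AY_le
  have hAH := P.AH_le
  have hAV := P.AV_le
  have hAW := P.AW_le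
  have hl := P.lunk_le
  have hh0 := P.hts_le 0
  have hsm := P.small_le
  have hZ := P.GXL_ge
  have hc := P.Acond_le s hν
  have hD := P.AD_le hE0 hE
  have h2n : (2 : ℝ) ≤ 2 ^ n := by
    calc (2 : ℝ) = 2 ^ 1 := by norm_num
      _ ≤ 2 ^ n := pow_le_pow_right₀ (by norm_num) P.hn
  have h2νn : (2 : ℝ) ^ ν ≤ 2 ^ n := pow_le_pow_right₀ (by norm_num) hν
  have hn1 : (2 : ℝ) ≤ n + 1 := by
    have hn : (1 : ℝ) ≤ n := by exact_mod_cast P.hn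
    linarith
  have hH0 : (0 : ℝ) ≤ P.H := by positivity
  have hG0 : (0 : ℝ) ≤ P.G := le_trans (by norm_num) P.sixteen_le_G
  have hY0 : 0 ≤ P.yload := P.yload_pos.le
  simp only [pow_zero, one_mul] at hh0
  have hK : P.logK 0 + P.AD E + 1 ≤ (535 / 100) * (P.G * P.X * P.L) := by
    unfold logK Acoef; linarith
  have h2n0 : (0 : ℝ) ≤ 2 ^ n := by positivity
  have hZ0 : 0 ≤ P.G * P.X * P.L := by linarith
  have hdiv : 2 ^ ν * (P.G * P.X * P.L) / (n + 1) ≤ 2 ^ n * (P.G * P.X * P.L) / 2 := by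
    rw [div_le_div_iff₀ (by positivity) (by norm_num)]
    have := mul_le_mul h2νn hn1 (by norm_num) h2n0
    nlinarith
  nlinarith [mul_le_mul_of_nonneg_left hK h2n0]

/-- **(C0′) with the unit-disc allowance `AY1`.** [cite: Nesterenko2003, §4.2 (4.30)–(4.31)] -/
theorem order_budget₁' (s : ℕ) {ν : ℕ} (hν : ν ≤ n) {E : ℝ} (hE0 : 0 ≤ E) (hE : E ≤ P.WL) {U : ℝ}
    (hU : 8 * 2 ^ n * (P.G * P.X * P.L) ≤ U) :
    P.AY1 + P.Acond s ν + 2 ^ n * (P.logK 0 + P.AD E + 1) < U := by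
  have hAY1 := P.AY1_le
  have hAH := P.AH_le
  have hAV := P.AV_le
  have hAW := P.AW_le
  have hl := P.lunk_le
  have hh0 := P.hts_le 0
  have hsm := P.small_le
  have hZ := P.GXL_ge
  have hc := P.Acond_le s hν
  have hD := P.AD_le hE0 hE
  have h2n : (2 : ℝ) ≤ 2 ^ n := by
    calc (2 : ℝ) = 2 ^ 1 := by norm_num
      _ ≤ 2 ^ n := pow_le_pow_right₀ (by norm_num) P.hn
  have h2νn : (2 : ℝ) ^ ν ≤ 2 ^ n := pow_le_pow_right₀ (by norm_num) hν
  have hn1 : (2 : ℝ) ≤ n + 1 := by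
    have hn : (1 : ℝ) ≤ n := by exact_mod_cast P.hn
    linarith
  have hH0 : (0 : ℝ) ≤ P.H := by positivity
  have hG0 : (0 : ℝ) ≤ P.G := le_trans (by norm_num) P.sixteen_le_G
  have hY0 : 0 ≤ P.yload := P.yload_pos.le
  simp only [pow_zero, one_mul] at hh0
  have hK : P.logK 0 + P.AD E + 1 ≤ (535 / 100) * (P.G * P.X * P.L) := by
    unfold logK Acoef; linarith
  have h2n0 : (0 : ℝ) ≤ 2 ^ n := by positivity
  have hZ0 : 0 ≤ P.G * P.X * P.L := by linarith
  have hdiv : 2 ^ ν * (P.G * P.X * P.L) / (n + 1) ≤ 2 ^ n * (P.G * P.X * P.L) / 2 := by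
    rw [div_le_div_iff₀ (by positivity) (by norm_num)]
    have := mul_le_mul h2νn hn1 (by norm_num) h2n0
    nlinarith
  nlinarith [mul_le_mul_of_nonneg_left hK h2n0]

/-! ### The schedule lemma for an arbitrary multiplicity -/

/-- For every multiplicity `t ≤ 8L`: `(31/8) X L ≤ ⌊4XL/(t+1)⌋ · (t+1) ≤ 4 X L` and `1 ≤ ⌊4XL/(t+1)⌋`
(the `q = 3` column `T_I = ⌊4L/3^I⌋ ≤ 4L` included). [cite: Nesterenko2003, (4.3), (4.25)] -/
theorem schedule_of_le {t : ℕ} (ht : t ≤ 8 * P.L) :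
    (31 / 8 : ℝ) * P.X * P.L ≤ ((4 * P.X * P.L / (t + 1) : ℕ) : ℝ) * (t + 1) ∧
      ((4 * P.X * P.L / (t + 1) : ℕ) : ℝ) * (t + 1) ≤ 4 * P.X * P.L ∧ 1 ≤ 4 * P.X * P.L / (t + 1) := by
  have hX := P.seventytwo_le_X
  have hX' := P.seventytwo_le_X'
  have hL := P.one_le_L
  have ht' : (t : ℝ) ≤ 8 * P.L := by exact_mod_cast ht
  refine ⟨?_, ?_, ?_⟩
  · have h := Nat.lt_div_mul_add (a := 4 * P.X * P.L) (b := t + 1) (by positivity)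
    have h' : ((4 * P.X * P.L : ℕ) : ℝ) < ((4 * P.X * P.L / (t + 1) * (t + 1) + (t + 1) : ℕ) : ℝ) := by
      exact_mod_cast h
    push_cast at h'
    nlinarith
  · exact_mod_cast Nat.div_mul_le_self (4 * P.X * P.L) (t + 1)
  · rw [Nat.one_le_div_iff (by positivity)]
    have h3 : 72 * P.L ≤ P.X * P.L := Nat.mul_le_mul_right _ hX'
    have h4 : 1 ≤ P.L := le_trans Nat.one_le_two_pow P.two_pow_le_L
    nlinarith [h3, h4]

end PadicG3Par

end Summit.ABC.StewartYu
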